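import Summits.QuantumFields.BalabanUV.T4Continuum.Support.ShellMeasureGradientTailPairing

/-!
# `T4Continuum.ShellMeasureGradientTailHDLocal` — WALL §2 (a) item (P4), the `HD`-terms of [Balaban1985Variational] (80)
# in BOND-LOCAL form, file 2∕2 (assembly): under ROW-SUM and COLUMN-SUM (decay-type) binders for `M = HD`, `M₃ = HD₃`,
# `K = Δ_πHD`, the bond-localised gradient of `V(A′) = −⟨J, HD₃A′⟩ − ⟨A′, Δ_πHDA′⟩ + ½⟨HDA′, Δ_πHDA′⟩ + V₀(A′ − HDA′)`
# has the (98) SHAPE `Prop4Hyp (locGrad V) C r` with `C` an EXPLICIT polynomial in the binders' constants and NO volume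
# factor (cell `pub-balaban`, sub-cell `t4`, spine estimate NE7c (node U5b), owner lineage `b2b-balaban-t4-ne7c-p1`
# gen 29, table `LEAVES-NE7c-P1.md` row S66 file 2b; imports file 2a `ShellMeasureGradientTailPairing` ONLY; [folklore];
# 0 sorry)

HONEST FRAMING.  Finite four-torus programme, rung (B)+1 only — NOT infinite volume, NOT a mass gap, NOT the Clay
problem, NOT summit progress; (B), `BetaPertHyp`, (B^μ) are not consumed.  NE7c (`T4IndicatorShell.ShellWeightBound`)
is NOT PRINTED and NOT PROVED; «NE7c ⇐ the named binders» (WALL `t4/b2b-balaban-t4-ne7c-p1/WALL-NE7c-P1.md` §2).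
Elementary calculus ([folklore]); nothing printed is asserted or cited as a fact: [Balaban1985Variational] p. 290 (80)
and p. 291 (85)–(89) are LOCATORS for the SHAPE; EVERY analytic input is a DISPLAYED binder — the operators behind
`M`∕`M₃`∕`K` are `H` ((46) = [5] Thm 3.12, the deep wall), `D`∕`D₃` (the `Cf` item, B11 (55)∕(73) kernel form; rows
S55∕S56∕S64) and `Δ_π` ([5] (3.132)); the plaquette part `V₀` enters through its bond-local bound of S62's shape
(`‖locGrad V₀ y‖_∞ ≤ C₀‖y‖²`, one grid: `ShellMeasureLocalGradientTailJet.prop4Hyp_wilsonV_ord₃`).  No `def … : Prop`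
(the one `def` is DATA: the functional `termsHD`).  HONEST DEPENDENCY (cell): continuum YM on T⁴ ⇐ BetaPertH ∧ nine
spine estimates (0/9 proved); BetaPertH ⇐ (D1) ∧ (D4) ∧ CAP+tail; G-an2-4 gates asym, D1 and NE2/3/4.

WHAT IS PROVED.  `termsHD π J M M₃ K V₀ A := −⟨J, M₃ A⟩_π − ⟨A, K A⟩_π + ½⟨M A, K A⟩_π + V₀ (A − M A)`;
**`norm_locGrad_termsHD_le`**: on `‖A‖_∞ < r ≤ 1`, with `M`, `M₃`, `K` analytic on the ball and `V₀` on `ball 0 R₀`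
(`2r ≤ R₀`), ROW-SUM type bounds `‖M A‖_∞ ≤ m_∞‖A‖²` (`m_∞r ≤ 1`), `‖K A‖_∞ ≤ k_∞‖A‖²`, COLUMN-SUM type bounds
`‖DM(A)(ι_bX)‖₁ ≤ m₁‖A‖‖X‖`, `‖DK(A)(ι_bX)‖₁ ≤ k₁‖A‖‖X‖`, `‖DM₃(A)(ι_bX)‖₁ ≤ c₃‖A‖²‖X‖`, `‖J‖_∞ ≤ j₀`, and
`‖locGrad V₀ y‖_∞ ≤ C₀‖y‖²` on `ball 0 R₀`:
  `‖locGrad V A‖_∞ ≤ (‖π‖·(j₀c₃ + k_∞ + k₁ + (m₁k_∞ + m_∞k₁)∕2) + 4C₀(1 + m₁))·‖A‖²_∞`;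
`analyticOnNhd_termsHD`; **`prop4Hyp_locGrad_termsHD`**: `Prop4Hyp (locGrad V) (that constant) r` — (85)–(89) TYPE as ONE
theorem, per bond, volume-free.  NOT HERE: «decay kernel ⇒ row∕column sums» (`e^{−δd(b,b′)}` kernels on `ℤᵈ` have both
sums `≤ c(δ, d)`; crew f3), the commutator terms (91)–(96), the weighted multi-scale norms of (97) on `Ω_j` (row S65), the
[dict] identification with END-II's `W𝒱 V` (node O).  No estimate of Bałaban's at a live level is discharged.
-/

noncomputable section

open Metric Set Filter
open scoped Topology

namespace Summit.QuantumFields.BalabanUV.T4Continuum.ShellMeasureGradientTailHDLocal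

open Literature.MathematicalPhysics.QuantumFieldTheory.Balaban1983to89
open B11Prop6Scheme (Prop4Hyp)
open ShellMeasureLocalGradientTail (sgl sgl_apply locGrad locGrad_apply locGrad_apply_apply
  fderiv_apply_eq_sum_locGrad differentiableOn_locGrad)
open ShellMeasureGradientTailPairing (norm₁ norm₁_single pair norm_fderiv_apply_le_locGrad analyticAt_pair
  norm_locGrad_pair_le norm_locGrad_comp_le)

variable {Λ : Type*} [Fintype Λ] [DecidableEq Λ] {𝔄 : Type*} [NormedAddCommGroup 𝔄] [NormedSpace ℂ 𝔄]

/-! ## §4 The four terms of (80) under DECAY binders: the bond-local (98) SHAPE, volume-free -/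

section HD

variable (π : 𝔄 →L[ℂ] 𝔄 →L[ℂ] ℂ) (J : Λ → 𝔄) (M M₃ K : (Λ → 𝔄) → Λ → 𝔄) (V₀ : (Λ → 𝔄) → ℂ)

/-- [Balaban1985Variational] (80) AT ONE GRID in the bond-pairing currency (locator only):
`V(A′) = −⟨J, HD₃(A′)⟩ − ⟨A′, Δ_πHD(A′)⟩ + ½⟨HD(A′), Δ_πHD(A′)⟩ + V₀(A′ − HD(A′))` with the binders `M = HD`, `M₃ = HD₃`,
`K = Δ_π HD` (print pairs `⟨HD₃(A′), J⟩`; the pairing is used symmetrically). [folklore] -/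
def termsHD (A : Λ → 𝔄) : ℂ :=
  -pair π J (M₃ A) - pair π A (K A) + (2 : ℂ)⁻¹ * pair π (M A) (K A) + V₀ (A - M A)

variable {π J M M₃ K V₀}

/-- **THE HD-TERMS' BOND-LOCAL GRADIENTS, VOLUME-FREE.**  On `‖A‖_∞ < r ≤ 1`, under: analyticity of `M`, `M₃`, `K` on the
ball and of `V₀` on `ball 0 R₀` (`2r ≤ R₀`); ROW-SUM type bounds `‖M A‖_∞ ≤ m_∞‖A‖²`, `‖K A‖_∞ ≤ k_∞‖A‖²` with
`m_∞·r ≤ 1`; COLUMN-SUM type bounds along single-bond directions `‖DM(A)(ι_b X)‖₁ ≤ m₁‖A‖‖X‖`,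
`‖DK(A)(ι_b X)‖₁ ≤ k₁‖A‖‖X‖`, `‖DM₃(A)(ι_b X)‖₁ ≤ c₃‖A‖²‖X‖`; `‖J‖_∞ ≤ j₀`; and the plaquette part's bond-local bound
`‖locGrad V₀ y‖_∞ ≤ C₀‖y‖²` on `ball 0 R₀` (S62's shape) — the bond-local gradient of (80)'s `V` obeys
`‖locGrad V A‖_∞ ≤ (‖π‖·(j₀c₃ + k_∞ + k₁ + (m₁k_∞ + m_∞k₁)∕2) + 4C₀(1 + m₁))·‖A‖²_∞` — NO `#Λ`. [folklore] -/
theorem norm_locGrad_termsHD_le {r R₀ m₀ m₁ k₀ k₁ c₃ C₀ j₀ : ℝ} (hr : 0 < r) (hr1 : r ≤ 1) (hrR₀ : 2 * r ≤ R₀)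
    (hm₀ : 0 ≤ m₀) (hm₁ : 0 ≤ m₁) (hk₀ : 0 ≤ k₀) (hk₁ : 0 ≤ k₁) (hc₃ : 0 ≤ c₃) (hC₀ : 0 ≤ C₀)
    (hsmall : m₀ * r ≤ 1) (hJ : ‖J‖ ≤ j₀)
    (hMa : AnalyticOnNhd ℂ M (ball 0 r)) (hM₃a : AnalyticOnNhd ℂ M₃ (ball 0 r)) (hKa : AnalyticOnNhd ℂ K (ball 0 r))
    (hV₀a : AnalyticOnNhd ℂ V₀ (ball 0 R₀))
    (hMb : ∀ A ∈ ball (0 : Λ → 𝔄) r, ‖M A‖ ≤ m₀ * ‖A‖ ^ 2) (hKb : ∀ A ∈ ball (0 : Λ → 𝔄) r, ‖K A‖ ≤ k₀ * ‖A‖ ^ 2)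
    (hM' : ∀ A ∈ ball (0 : Λ → 𝔄) r, ∀ (b : Λ) (X : 𝔄), norm₁ (fderiv ℂ M A (Pi.single b X)) ≤ m₁ * ‖A‖ * ‖X‖)
    (hK' : ∀ A ∈ ball (0 : Λ → 𝔄) r, ∀ (b : Λ) (X : 𝔄), norm₁ (fderiv ℂ K A (Pi.single b X)) ≤ k₁ * ‖A‖ * ‖X‖)
    (hM₃' : ∀ A ∈ ball (0 : Λ → 𝔄) r, ∀ (b : Λ) (X : 𝔄),
      norm₁ (fderiv ℂ M₃ A (Pi.single b X)) ≤ c₃ * ‖A‖ ^ 2 * ‖X‖)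
    (hV₀g : ∀ y ∈ ball (0 : Λ → 𝔄) R₀, ‖locGrad V₀ y‖ ≤ C₀ * ‖y‖ ^ 2) :
    ∀ A ∈ ball (0 : Λ → 𝔄) r, ‖locGrad (termsHD π J M M₃ K V₀) A‖ ≤
      (‖π‖ * (j₀ * c₃ + k₀ + k₁ + (m₁ * k₀ + m₀ * k₁) / 2) + 4 * C₀ * (1 + m₁)) * ‖A‖ ^ 2 := by
  intro A hA
  have ha : ‖A‖ < r := mem_ball_zero_iff.1 hA
  have ha0 : 0 ≤ ‖A‖ := norm_nonneg A
  have ha1 : ‖A‖ ≤ 1 := ha.le.trans hr1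
  have hj₀ : 0 ≤ j₀ := (norm_nonneg J).trans hJ
  have hπ : 0 ≤ ‖π‖ := norm_nonneg π
  -- differentiability of the pieces at `A`
  have hMd : HasFDerivAt M (fderiv ℂ M A) A := ((hMa A hA).differentiableAt).hasFDerivAt
  have hM₃d : HasFDerivAt M₃ (fderiv ℂ M₃ A) A := ((hM₃a A hA).differentiableAt).hasFDerivAt
  have hKd : HasFDerivAt K (fderiv ℂ K A) A := ((hKa A hA).differentiableAt).hasFDerivAt
  have hJd : HasFDerivAt (fun _ : Λ → 𝔄 => J) (0 : (Λ → 𝔄) →L[ℂ] (Λ → 𝔄)) A := hasFDerivAt_const J A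
  have hId : HasFDerivAt (fun A : Λ → 𝔄 => A) (ContinuousLinearMap.id ℂ (Λ → 𝔄)) A := hasFDerivAt_id A
  -- the substituted point `Θ A = A − M A` lies in `ball 0 (2‖A‖) ⊆ ball 0 R₀`
  have hΘn : ‖A - M A‖ ≤ 2 * ‖A‖ := by
    have h1 : ‖M A‖ ≤ m₀ * ‖A‖ ^ 2 := hMb A hA
    have h2 : m₀ * ‖A‖ ^ 2 ≤ ‖A‖ := by nlinarith
    calc ‖A - M A‖ ≤ ‖A‖ + ‖M A‖ := norm_sub_le _ _
      _ ≤ 2 * ‖A‖ := by linarith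
  have hΘmem : A - M A ∈ ball (0 : Λ → 𝔄) R₀ := mem_ball_zero_iff.2 (by linarith)
  have hΘ : HasFDerivAt (fun A => A - M A) (ContinuousLinearMap.id ℂ (Λ → 𝔄) - fderiv ℂ M A) A := hId.sub hMd
  have hV₀d : DifferentiableAt ℂ V₀ (A - M A) := (hV₀a _ hΘmem).differentiableAt
  -- PER TERM, PER BOND
  have hb : ∀ b : Λ, ‖locGrad (termsHD π J M M₃ K V₀) A b‖ ≤
      (‖π‖ * (j₀ * c₃ + k₀ + k₁ + (m₁ * k₀ + m₀ * k₁) / 2) + 4 * C₀ * (1 + m₁)) * ‖A‖ ^ 2 := by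
    intro b
    -- P1
    have h1 : ‖locGrad (fun x => pair π J (M₃ x)) A b‖ ≤ ‖π‖ * (j₀ * c₃) * ‖A‖ ^ 2 := by
      have h := norm_locGrad_pair_le π (F := fun _ => J) hJd hM₃d b le_rfl (by positivity : 0 ≤ c₃ * ‖A‖ ^ 2)
        (fun X => by simp [norm₁]) (fun X => by
          calc norm₁ (fderiv ℂ M₃ A (Pi.single b X)) ≤ c₃ * ‖A‖ ^ 2 * ‖X‖ := hM₃' A hA b X
            _ = c₃ * ‖A‖ ^ 2 * ‖X‖ := rfl)
      calc _ ≤ ‖π‖ * (0 * ‖M₃ A‖ + ‖J‖ * (c₃ * ‖A‖ ^ 2)) := h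
        _ ≤ ‖π‖ * (0 * ‖M₃ A‖ + j₀ * (c₃ * ‖A‖ ^ 2)) := by
          apply mul_le_mul_of_nonneg_left _ hπ
          have e : ‖J‖ * (c₃ * ‖A‖ ^ 2) ≤ j₀ * (c₃ * ‖A‖ ^ 2) :=
            mul_le_mul_of_nonneg_right hJ (by positivity)
          linarith
        _ = ‖π‖ * (j₀ * c₃) * ‖A‖ ^ 2 := by ring
    -- P2
    have h2 : ‖locGrad (fun x => pair π x (K x)) A b‖ ≤ ‖π‖ * (k₀ + k₁) * ‖A‖ ^ 2 := by
      have h := norm_locGrad_pair_le π (F := fun x => x) hId hKd b zero_le_one (by positivity : 0 ≤ k₁ * ‖A‖)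
        (fun X => by rw [ContinuousLinearMap.id_apply, norm₁_single, one_mul]) (fun X => by
          calc norm₁ (fderiv ℂ K A (Pi.single b X)) ≤ k₁ * ‖A‖ * ‖X‖ := hK' A hA b X
            _ = k₁ * ‖A‖ * ‖X‖ := rfl)
      calc _ ≤ ‖π‖ * (1 * ‖K A‖ + ‖A‖ * (k₁ * ‖A‖)) := h
        _ ≤ ‖π‖ * (k₀ * ‖A‖ ^ 2 + ‖A‖ * (k₁ * ‖A‖)) := by
          apply mul_le_mul_of_nonneg_left _ hπ
          have e : 1 * ‖K A‖ ≤ k₀ * ‖A‖ ^ 2 := by rw [one_mul]; exact hKb A hA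
          linarith
        _ = ‖π‖ * (k₀ + k₁) * ‖A‖ ^ 2 := by ring
    -- P3
    have h3 : ‖locGrad (fun x => pair π (M x) (K x)) A b‖ ≤ ‖π‖ * (m₁ * k₀ + m₀ * k₁) * ‖A‖ ^ 2 := by
      have h := norm_locGrad_pair_le π hMd hKd b (by positivity : 0 ≤ m₁ * ‖A‖) (by positivity : 0 ≤ k₁ * ‖A‖)
        (fun X => hM' A hA b X) (fun X => hK' A hA b X)
      calc _ ≤ ‖π‖ * (m₁ * ‖A‖ * ‖K A‖ + ‖M A‖ * (k₁ * ‖A‖)) := h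
        _ ≤ ‖π‖ * (m₁ * ‖A‖ * (k₀ * ‖A‖ ^ 2) + m₀ * ‖A‖ ^ 2 * (k₁ * ‖A‖)) := by
          apply mul_le_mul_of_nonneg_left _ hπ
          have e1 := mul_le_mul_of_nonneg_left (hKb A hA) (by positivity : 0 ≤ m₁ * ‖A‖)
          have e2 := mul_le_mul_of_nonneg_right (hMb A hA) (by positivity : 0 ≤ k₁ * ‖A‖)
          linarith
        _ = ‖π‖ * (m₁ * k₀ + m₀ * k₁) * ‖A‖ ^ 2 * ‖A‖ := by ring
        _ ≤ ‖π‖ * (m₁ * k₀ + m₀ * k₁) * ‖A‖ ^ 2 * 1 :=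
          mul_le_mul_of_nonneg_left ha1 (by positivity)
        _ = ‖π‖ * (m₁ * k₀ + m₀ * k₁) * ‖A‖ ^ 2 := by ring
    -- P4
    have h4 : ‖locGrad (V₀ ∘ fun A => A - M A) A b‖ ≤ 4 * C₀ * (1 + m₁) * ‖A‖ ^ 2 := by
      have h := norm_locGrad_comp_le (V₀ := V₀) hΘ hV₀d b (by positivity : 0 ≤ m₁ * ‖A‖) (fun X => hM' A hA b X)
      have hg : ‖locGrad V₀ (A - M A)‖ ≤ C₀ * (2 * ‖A‖) ^ 2 :=
        (hV₀g _ hΘmem).trans (mul_le_mul_of_nonneg_left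
          (pow_le_pow_left₀ (norm_nonneg _) hΘn 2) hC₀)
      have hm : 1 + m₁ * ‖A‖ ≤ 1 + m₁ * 1 := by
        have := mul_le_mul_of_nonneg_left ha1 hm₁
        linarith
      calc _ ≤ ‖locGrad V₀ (A - M A)‖ * (1 + m₁ * ‖A‖) := h
        _ ≤ C₀ * (2 * ‖A‖) ^ 2 * (1 + m₁ * 1) :=
          mul_le_mul hg hm (by positivity) (by positivity)
        _ = 4 * C₀ * (1 + m₁) * ‖A‖ ^ 2 := by ring
    -- the derivative of the sum
    have hP1d : DifferentiableAt ℂ (fun x => pair π J (M₃ x)) A :=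
      (analyticAt_pair π analyticAt_const (hM₃a A hA)).differentiableAt
    have hP2d : DifferentiableAt ℂ (fun x => pair π x (K x)) A :=
      (analyticAt_pair π analyticAt_id (hKa A hA)).differentiableAt
    have hP3d : DifferentiableAt ℂ (fun x => pair π (M x) (K x)) A :=
      (analyticAt_pair π (hMa A hA) (hKa A hA)).differentiableAt
    have hP4d : DifferentiableAt ℂ (V₀ ∘ fun A => A - M A) A := hV₀d.comp A hΘ.differentiableAt
    have hT : HasFDerivAt (termsHD π J M M₃ K V₀)
        (-fderiv ℂ (fun x => pair π J (M₃ x)) A - fderiv ℂ (fun x => pair π x (K x)) A +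
          (2 : ℂ)⁻¹ • fderiv ℂ (fun x => pair π (M x) (K x)) A + fderiv ℂ (V₀ ∘ fun A => A - M A) A) A := by
      have h := ((hP1d.hasFDerivAt.neg.sub hP2d.hasFDerivAt).add (hP3d.hasFDerivAt.const_mul (2 : ℂ)⁻¹)).add
        hP4d.hasFDerivAt
      exact h
    refine ContinuousLinearMap.opNorm_le_bound _ (by positivity) fun X => ?_
    rw [locGrad_apply_apply, hT.fderiv]
    set s := (Pi.single b X : Λ → 𝔄) with hs
    set T1 := fderiv ℂ (fun x => pair π J (M₃ x)) A with hT1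
    set T2 := fderiv ℂ (fun x => pair π x (K x)) A with hT2
    set T3 := fderiv ℂ (fun x => pair π (M x) (K x)) A with hT3
    set T4 := fderiv ℂ (V₀ ∘ fun A => A - M A) A with hT4
    have e1 : ‖T1 s‖ ≤ ‖π‖ * (j₀ * c₃) * ‖A‖ ^ 2 * ‖X‖ := by
      have e := (locGrad (fun x => pair π J (M₃ x)) A b).le_opNorm X
      rw [locGrad_apply_apply] at e
      exact e.trans (mul_le_mul_of_nonneg_right h1 (norm_nonneg X))
    have e2 : ‖T2 s‖ ≤ ‖π‖ * (k₀ + k₁) * ‖A‖ ^ 2 * ‖X‖ := by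
      have e := (locGrad (fun x => pair π x (K x)) A b).le_opNorm X
      rw [locGrad_apply_apply] at e
      exact e.trans (mul_le_mul_of_nonneg_right h2 (norm_nonneg X))
    have e3 : ‖T3 s‖ ≤ ‖π‖ * (m₁ * k₀ + m₀ * k₁) * ‖A‖ ^ 2 * ‖X‖ := by
      have e := (locGrad (fun x => pair π (M x) (K x)) A b).le_opNorm X
      rw [locGrad_apply_apply] at e
      exact e.trans (mul_le_mul_of_nonneg_right h3 (norm_nonneg X))
    have e4 : ‖T4 s‖ ≤ 4 * C₀ * (1 + m₁) * ‖A‖ ^ 2 * ‖X‖ := by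
      have e := (locGrad (V₀ ∘ fun A => A - M A) A b).le_opNorm X
      rw [locGrad_apply_apply] at e
      exact e.trans (mul_le_mul_of_nonneg_right h4 (norm_nonneg X))
    have happ : (-T1 - T2 + (2 : ℂ)⁻¹ • T3 + T4) s = -(T1 s) - T2 s + (2 : ℂ)⁻¹ • T3 s + T4 s := rfl
    rw [happ]
    have hcomb : ‖-(T1 s) - T2 s + (2 : ℂ)⁻¹ • T3 s + T4 s‖ ≤ ‖T1 s‖ + ‖T2 s‖ + 2⁻¹ * ‖T3 s‖ + ‖T4 s‖ := by
      have hsm : ‖(2 : ℂ)⁻¹ • T3 s‖ = 2⁻¹ * ‖T3 s‖ := by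
        rw [norm_smul, norm_inv, Complex.norm_ofNat]
      calc ‖-(T1 s) - T2 s + (2 : ℂ)⁻¹ • T3 s + T4 s‖
          ≤ ‖-(T1 s) - T2 s + (2 : ℂ)⁻¹ • T3 s‖ + ‖T4 s‖ := norm_add_le _ _
        _ ≤ ‖-(T1 s) - T2 s‖ + ‖(2 : ℂ)⁻¹ • T3 s‖ + ‖T4 s‖ := by
            have := norm_add_le (-(T1 s) - T2 s) ((2 : ℂ)⁻¹ • T3 s)
            linarith
        _ ≤ ‖-(T1 s)‖ + ‖T2 s‖ + ‖(2 : ℂ)⁻¹ • T3 s‖ + ‖T4 s‖ := by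
            have := norm_sub_le (-(T1 s)) (T2 s)
            linarith
        _ = ‖T1 s‖ + ‖T2 s‖ + 2⁻¹ * ‖T3 s‖ + ‖T4 s‖ := by rw [norm_neg, hsm]
    calc ‖-(T1 s) - T2 s + (2 : ℂ)⁻¹ • T3 s + T4 s‖ ≤ ‖T1 s‖ + ‖T2 s‖ + 2⁻¹ * ‖T3 s‖ + ‖T4 s‖ := hcomb
      _ ≤ ‖π‖ * (j₀ * c₃) * ‖A‖ ^ 2 * ‖X‖ + ‖π‖ * (k₀ + k₁) * ‖A‖ ^ 2 * ‖X‖ +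
            2⁻¹ * (‖π‖ * (m₁ * k₀ + m₀ * k₁) * ‖A‖ ^ 2 * ‖X‖) + 4 * C₀ * (1 + m₁) * ‖A‖ ^ 2 * ‖X‖ := by
          have e3' := mul_le_mul_of_nonneg_left e3 (by norm_num : (0 : ℝ) ≤ 2⁻¹)
          linarith
      _ = (‖π‖ * (j₀ * c₃ + k₀ + k₁ + (m₁ * k₀ + m₀ * k₁) / 2) + 4 * C₀ * (1 + m₁)) * ‖A‖ ^ 2 * ‖X‖ := by
          ring
  exact (pi_norm_le_iff_of_nonneg (by positivity)).2 hb

omit [DecidableEq Λ] in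
/-- (80)'s `V` is analytic on the ball under the same analyticity binders. [folklore] -/
theorem analyticOnNhd_termsHD {r R₀ m₀ : ℝ} (hrR₀ : 2 * r ≤ R₀) (hsmall : m₀ * r ≤ 1)
    (hMa : AnalyticOnNhd ℂ M (ball 0 r)) (hM₃a : AnalyticOnNhd ℂ M₃ (ball 0 r)) (hKa : AnalyticOnNhd ℂ K (ball 0 r))
    (hV₀a : AnalyticOnNhd ℂ V₀ (ball 0 R₀)) (hMb : ∀ A ∈ ball (0 : Λ → 𝔄) r, ‖M A‖ ≤ m₀ * ‖A‖ ^ 2) :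
    AnalyticOnNhd ℂ (termsHD π J M M₃ K V₀) (ball (0 : Λ → 𝔄) r) := by
  intro A hA
  have ha : ‖A‖ < r := mem_ball_zero_iff.1 hA
  have hΘmem : A - M A ∈ ball (0 : Λ → 𝔄) R₀ := by
    have h1 : ‖M A‖ ≤ m₀ * ‖A‖ ^ 2 := hMb A hA
    have h2 : m₀ * ‖A‖ ^ 2 ≤ ‖A‖ := by nlinarith [norm_nonneg A]
    refine mem_ball_zero_iff.2 ?_
    calc ‖A - M A‖ ≤ ‖A‖ + ‖M A‖ := norm_sub_le _ _
      _ < R₀ := by linarith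
  have hΘa : AnalyticAt ℂ (fun A => A - M A) A := analyticAt_id.sub (hMa A hA)
  have hP4 : AnalyticAt ℂ (fun A => V₀ (A - M A)) A :=
    AnalyticAt.comp (g := V₀) (f := fun A => A - M A) (x := A) (hV₀a _ hΘmem) hΘa
  have hP1 : AnalyticAt ℂ (fun x => pair π J (M₃ x)) A := analyticAt_pair π analyticAt_const (hM₃a A hA)
  have hP2 : AnalyticAt ℂ (fun x => pair π x (K x)) A := analyticAt_pair π analyticAt_id (hKa A hA)
  have hP3 : AnalyticAt ℂ (fun x => (2 : ℂ)⁻¹ * pair π (M x) (K x)) A :=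
    analyticAt_const.mul (analyticAt_pair π (hMa A hA) (hKa A hA))
  have h : AnalyticAt ℂ (fun x => -pair π J (M₃ x) - pair π x (K x) + (2 : ℂ)⁻¹ * pair π (M x) (K x) +
      V₀ (x - M x)) A := ((hP1.neg.sub hP2).add hP3).add hP4
  exact h

/-- **THE (98) SHAPE FOR (80)'s `V` — BOND-LOCAL, VOLUME-FREE, OVER DECAY BINDERS** (B11 (85)–(89) TYPE as ONE
theorem at one grid; (46) = [5] Thm 3.12 and (73)∕(55) stay DISPLAYED as the row∕column-sum binders of `M`, `M₃`, `K`;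
nothing printed is asserted): `Prop4Hyp (locGrad V) (‖π‖·(j₀c₃ + k_∞ + k₁ + (m₁k_∞ + m_∞k₁)∕2) + 4C₀(1 + m₁)) r`.
[folklore] -/
theorem prop4Hyp_locGrad_termsHD {r R₀ m₀ m₁ k₀ k₁ c₃ C₀ j₀ : ℝ} (hr : 0 < r) (hr1 : r ≤ 1) (hrR₀ : 2 * r ≤ R₀)
    (hm₀ : 0 ≤ m₀) (hm₁ : 0 ≤ m₁) (hk₀ : 0 ≤ k₀) (hk₁ : 0 ≤ k₁) (hc₃ : 0 ≤ c₃) (hC₀ : 0 ≤ C₀)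
    (hsmall : m₀ * r ≤ 1) (hJ : ‖J‖ ≤ j₀)
    (hMa : AnalyticOnNhd ℂ M (ball 0 r)) (hM₃a : AnalyticOnNhd ℂ M₃ (ball 0 r)) (hKa : AnalyticOnNhd ℂ K (ball 0 r))
    (hV₀a : AnalyticOnNhd ℂ V₀ (ball 0 R₀))
    (hMb : ∀ A ∈ ball (0 : Λ → 𝔄) r, ‖M A‖ ≤ m₀ * ‖A‖ ^ 2) (hKb : ∀ A ∈ ball (0 : Λ → 𝔄) r, ‖K A‖ ≤ k₀ * ‖A‖ ^ 2)
    (hM' : ∀ A ∈ ball (0 : Λ → 𝔄) r, ∀ (b : Λ) (X : 𝔄), norm₁ (fderiv ℂ M A (Pi.single b X)) ≤ m₁ * ‖A‖ * ‖X‖)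
    (hK' : ∀ A ∈ ball (0 : Λ → 𝔄) r, ∀ (b : Λ) (X : 𝔄), norm₁ (fderiv ℂ K A (Pi.single b X)) ≤ k₁ * ‖A‖ * ‖X‖)
    (hM₃' : ∀ A ∈ ball (0 : Λ → 𝔄) r, ∀ (b : Λ) (X : 𝔄),
      norm₁ (fderiv ℂ M₃ A (Pi.single b X)) ≤ c₃ * ‖A‖ ^ 2 * ‖X‖)
    (hV₀g : ∀ y ∈ ball (0 : Λ → 𝔄) R₀, ‖locGrad V₀ y‖ ≤ C₀ * ‖y‖ ^ 2) :
    Prop4Hyp (locGrad (termsHD π J M M₃ K V₀))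
      (‖π‖ * (j₀ * c₃ + k₀ + k₁ + (m₁ * k₀ + m₀ * k₁) / 2) + 4 * C₀ * (1 + m₁)) r where
  quad Y hY := norm_locGrad_termsHD_le hr hr1 hrR₀ hm₀ hm₁ hk₀ hk₁ hc₃ hC₀ hsmall hJ hMa hM₃a hKa hV₀a hMb hKb hM'
    hK' hM₃' hV₀g Y (mem_ball_zero_iff.2 hY)
  differentiableOn := by
    have h : {Y : Λ → 𝔄 | ‖Y‖ < r} = ball (0 : Λ → 𝔄) r := by
      ext Y
      simp
    rw [h]
    exact differentiableOn_locGrad (analyticOnNhd_termsHD hrR₀ hsmall hMa hM₃a hKa hV₀a hMb)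

end HD

end Summit.QuantumFields.BalabanUV.T4Continuum.ShellMeasureGradientTailHDLocal

end
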